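import Summits.Ventures.Crystal3D.Theorems.StickyWulffConstantTextureBuildRiserCurtainKey
import HarnessLib

/-!
# The RISER PACKAGE (B6), part 13: the CURTAIN COUNT `curtainSpecialSum ≤ riserSum`
# (lane T, crux `TextureLiminfV5`, stmt-Ventures-23912; design memo HOME/wulff-p2/g21/B6-DESIGN-g21.md §3; target `RiserPackage₇` of '…TextureBuildMeshV7')

HONEST FRAMING. Venture `Summits/Ventures/Crystal3D` (cell `crystal3d-full`), route `route-Ventures-StickyWulffConstant`, helper `--supports` the
law-v5 crux `TextureLiminfV5` (stmt-Ventures-23912).  Standard axioms; no mesh constructed; F-C1 not moved.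
Every surviving curtain term is a wall term ('…RiserCurtainKey'); a wall term with non-null contact is charged to the budget entry
`β = (owner r', claimed site b, vacant in-plane site v)` of `riserSum = ½·#{β}` — GLOBALLY (the datum is the frame-independent bisector datum of
`(b, v)`, all facets charged to `β` lie in `wallRect b v (rn r')`, the cells are pairwise disjoint): per entry and orientation `≤ (2/3)√2`
(`TexInput.wall_sum_le`, `charge_sum_le`), so `curtainSpecialSum ≤ (13/50)·2·(2/3)√2·#{β} = (52√2/75)·riserSum ≤ riserSum`
(`Mesh₇.curtain_term_le`, **`Mesh₇.riserInput_curtain`** — the SECOND conjunct of `RiserPackage₇`).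
-/

noncomputable section

open scoped BigOperators InnerProductSpace

namespace Summit.Ventures.Crystal3D.Cruxes.TextureLiminf.TexShadow

open Summit.Ventures.Crystal3D Summit.Ventures.Crystal3D.Theorems Set
open Summit.Ventures.Crystal3D.TentCertificate (hB hB_sq hB_pos)

/-! ### The wall-plane area bound -/

namespace TexInput

variable {C R₀ : ℝ} {N : ℕ} {x : Fin N → E3} {rc : RiseredCover C R₀ N x} {δ : ℝ} {μ : Mesh₅ rc δ} (I : TexInput rc μ)

open scoped Classical in
/-- **Σ over (pieces carrying `q` whose `q`-facet lies in `R`) × (pieces carrying `antip q`) of the contact areas along `q` is at most `facetArea R`.** -/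
theorem wall_sum_le {q : E3 × ℝ} (hq1 : ‖q.1‖ = 1) {R : Set E3} (hR : R ⊆ {y : E3 | ⟪q.1, y⟫_ℝ = q.2}) (hRc : IsClosed R)
    (hRb : Bornology.IsBounded R) :
    ∑ j ∈ Finset.univ.filter (fun j => q ∈ I.cells.Hp j ∧ closure (polytope (I.cells.Hp j)) ∩ {y : E3 | ⟪q.1, y⟫_ℝ = q.2} ⊆ R),
      ∑ j' ∈ Finset.univ.filter (fun j' => antip q ∈ I.cells.Hp j'), facetArea (I.contact j j' q) q.1 ≤ facetArea R q.1 := by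
  set n : E3 := q.1 with hn
  set lvl : ℝ := q.2 with hlvl
  set Pl : Set E3 := {y : E3 | ⟪n, y⟫_ℝ = lvl} with hPl
  have hPl' : Pl = {y : E3 | ⟪-n, y⟫_ℝ = -lvl} := by ext y; simp only [hPl, mem_setOf_eq, inner_neg_left, neg_inj]
  have hPlc : IsClosed Pl := isClosed_eq (continuous_const.inner continuous_id) continuous_const
  have hn' : ‖-n‖ = 1 := by rw [norm_neg]; exact hq1
  set Jm := Finset.univ.filter (fun j => q ∈ I.cells.Hp j ∧ closure (polytope (I.cells.Hp j)) ∩ Pl ⊆ R) with hJm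
  set Jp := Finset.univ.filter (fun j' => antip q ∈ I.cells.Hp j') with hJp
  have hinner : ∀ j ∈ Jm, ∑ j' ∈ Jp, facetArea (I.contact j j' q) n ≤ facetArea (closure (polytope (I.cells.Hp j)) ∩ Pl) n := by
    intro j hj
    set Rj : Set E3 := closure (polytope (I.cells.Hp j)) ∩ Pl with hRj
    have hRjc : IsClosed Rj := isClosed_closure.inter hPlc
    have hRjb : Bornology.IsBounded Rj := (I.cells.hbd_Hp j).closure.subset inter_subset_left
    have hRjPl : Rj ⊆ {y : E3 | ⟪-n, y⟫_ℝ = -lvl} := fun y hy => by rw [← hPl']; exact hy.2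
    calc ∑ j' ∈ Jp, facetArea (I.contact j j' q) n
        = ∑ j' ∈ Jp, facetArea (closure (polytope (I.cells.Hp j')) ∩ Rj) (-n) := by
          refine Finset.sum_congr rfl fun j' _ => ?_
          have hset : I.contact j j' q = closure (polytope (I.cells.Hp j')) ∩ Rj := by
            ext y; simp only [contact, hRj, hPl, mem_inter_iff, mem_setOf_eq]; tauto
          rw [hset, facetArea_neg]
      _ ≤ facetArea Rj (-n) :=
          sum_facetArea_inter_le_of_sameSide Jp I.cells.Hp hn' (fun j' hj' => polytope_subset_halfspace (Finset.mem_filter.1 hj').2)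
            (fun a _ b _ hab => I.cells.hdisj_Hp a b hab) hRjPl hRjc hRjb
      _ = facetArea Rj n := facetArea_neg _ _
  calc ∑ j ∈ Jm, ∑ j' ∈ Jp, facetArea (I.contact j j' q) n
      ≤ ∑ j ∈ Jm, facetArea (closure (polytope (I.cells.Hp j)) ∩ Pl) n := Finset.sum_le_sum hinner
    _ = ∑ j ∈ Jm, facetArea (closure (polytope (I.cells.Hp j)) ∩ R) n := by
        refine Finset.sum_congr rfl fun j hj => ?_
        obtain ⟨-, hsub⟩ := (Finset.mem_filter.1 hj).2
        have hset : closure (polytope (I.cells.Hp j)) ∩ Pl = closure (polytope (I.cells.Hp j)) ∩ R := by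
          ext y; exact ⟨fun hy => ⟨hy.1, hsub hy⟩, fun hy => ⟨hy.1, hR hy.2⟩⟩
        rw [hset]
    _ ≤ facetArea R n :=
        sum_facetArea_inter_le_of_sameSide Jm I.cells.Hp hq1 (fun j hj => polytope_subset_halfspace (Finset.mem_filter.1 hj).2.1)
          (fun a _ b _ hab => I.cells.hdisj_Hp a b hab) hR hRc hRb

end TexInput

/-! ### The budget index set and the charges -/

section Budget

variable {C R₀ : ℝ} {N : ℕ} {x : Fin N → E3}

/-- the budget index set: `(r', b, v)` with `b` owned by riser piece `r'` and `v` a VACANT in-plane site of `b`. -/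
def bud (rc : RiseredCover C R₀ N x) : Finset (Fin rc.nr × E3 × E3) :=
  Finset.univ.biUnion fun r' => (rc.rown r').biUnion fun b => ((rc.rV r' b) \ rc.X').image fun v => (r', b, v)

/-- the bisector datum of the pair `(b, v)`: normal `v − b`, level `⟪v − b, b⟫ + ½`. -/
def bdat {n : ℕ} (β : Fin n × E3 × E3) : E3 × ℝ := (β.2.2 - β.2.1, ⟪β.2.2 - β.2.1, β.2.1⟫_ℝ + 1 / 2)

/-- `#bud ≤ 2·riserSum`. -/
theorem card_bud_le (rc : RiseredCover C R₀ N x) : ((bud rc).card : ℝ) ≤ 2 * rc.riserSum := by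
  classical
  have h1 : (bud rc).card ≤ ∑ r', ∑ b ∈ rc.rown r', ((rc.rV r' b) \ rc.X').card := by
    refine (Finset.card_biUnion_le).trans (Finset.sum_le_sum fun r' _ => ?_)
    refine (Finset.card_biUnion_le).trans (Finset.sum_le_sum fun b _ => Finset.card_image_le)
  have h2 : (((bud rc).card : ℕ) : ℝ) ≤ ((∑ r', ∑ b ∈ rc.rown r', ((rc.rV r' b) \ rc.X').card : ℕ) : ℝ) := by exact_mod_cast h1
  have h3 : 2 * rc.riserSum = ((∑ r', ∑ b ∈ rc.rown r', ((rc.rV r' b) \ rc.X').card : ℕ) : ℝ) := by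
    unfold RiseredCover.riserSum riserBudget
    push_cast
    rw [Finset.mul_sum]
    refine Finset.sum_congr rfl fun r' _ => ?_
    ring
  rw [h3]; exact h2

variable {rc : RiseredCover C R₀ N x} {δ : ℝ} {μ : Mesh₅ rc δ}

open scoped Classical in
/-- the CHARGE of the ordered pair of pieces `(j, j')` to the entry `β`: the contact area along `bdat β`, when `β` is good, `j` carries `bdat β` with its
facet inside the wall rectangle, and `j'` carries `antip (bdat β)`; else `0`. -/
def charge (I : TexInput rc μ) (β : Fin rc.nr × E3 × E3) (j j' : Fin I.cells.M) : ℝ :=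
  if (‖β.2.2 - β.2.1‖ = 1 ∧ ⟪β.2.2 - β.2.1, rc.rn β.1⟫_ℝ = 0) ∧ bdat β ∈ I.cells.Hp j ∧
      closure (polytope (I.cells.Hp j)) ∩ {y : E3 | ⟪(bdat β).1, y⟫_ℝ = (bdat β).2} ⊆ wallRect β.2.1 β.2.2 (rc.rn β.1) ∧ antip (bdat β) ∈ I.cells.Hp j'
    then facetArea (I.contact j j' (bdat β)) (bdat β).1 else 0

/-- Charges are nonnegative. -/
theorem charge_nonneg (I : TexInput rc μ) (β : Fin rc.nr × E3 × E3) (j j' : Fin I.cells.M) : 0 ≤ charge I β j j' := by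
  unfold charge; split_ifs; exacts [facetArea_nonneg _ _, le_rfl]

/-- The wall rectangle of a good entry is closed, bounded, and inside the bisector plane. -/
theorem wallRect_props {b v n₀ : E3} (hd : ‖v - b‖ = 1) (hn : ‖n₀‖ = 1) (hdn : ⟪v - b, n₀⟫_ℝ = 0) :
    IsClosed (wallRect b v n₀) ∧ Bornology.IsBounded (wallRect b v n₀) ∧
      wallRect b v n₀ ⊆ {y : E3 | ⟪v - b, y⟫_ℝ = ⟪v - b, b⟫_ℝ + 1 / 2} := by
  have he : ‖wcross (v - b) n₀‖ = 1 := norm_wcross hd hn hdn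
  have hde : ⟪v - b, wcross (v - b) n₀⟫_ℝ = 0 := by rw [real_inner_comm]; exact inner_wcross_left _ _
  have hen : ⟪wcross (v - b) n₀, n₀⟫_ℝ = 0 := inner_wcross_right _ _
  refine ⟨?_, ?_, fun y hy => hy.1⟩
  · have hset : wallRect b v n₀ = {y : E3 | ⟪v - b, y⟫_ℝ = ⟪v - b, b⟫_ℝ + 1 / 2} ∩
        ({y : E3 | |⟪wcross (v - b) n₀, y⟫_ℝ - ⟪wcross (v - b) n₀, b⟫_ℝ| ≤ Real.sqrt 3 / 6} ∩
          ({y : E3 | ⟪n₀, b⟫_ℝ - hB ≤ ⟪n₀, y⟫_ℝ} ∩ {y : E3 | ⟪n₀, y⟫_ℝ ≤ ⟪n₀, b⟫_ℝ + hB})) := by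
      ext y; simp only [wallRect, mem_inter_iff, mem_setOf_eq]
    rw [hset]
    have hc : ∀ w : E3, Continuous fun y : E3 => ⟪w, y⟫_ℝ := fun w => continuous_const.inner continuous_id
    refine (isClosed_eq (hc _) continuous_const).inter ((isClosed_le ((hc _).sub continuous_const).abs continuous_const).inter
      ((isClosed_le continuous_const (hc _)).inter (isClosed_le (hc _) continuous_const)))
  · refine (Metric.isBounded_closedBall (x := b) (r := 1)).subset fun y hy => ?_
    obtain ⟨h1, h2, h3, h4⟩ := hy
    rw [Metric.mem_closedBall, dist_eq_norm]
    have hp := parseval_triple hd he hn hde hdn hen (y - b)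
    have e1 : ⟪v - b, y - b⟫_ℝ = 1 / 2 := by rw [inner_sub_right]; linarith
    have e2 : |⟪wcross (v - b) n₀, y - b⟫_ℝ| ≤ Real.sqrt 3 / 6 := by rw [inner_sub_right]; exact h2
    have e3 : |⟪n₀, y - b⟫_ℝ| ≤ hB := by rw [inner_sub_right, abs_le]; constructor <;> linarith
    have h36 : (Real.sqrt 3 / 6) ^ 2 = 1 / 12 := by rw [div_pow, Real.sq_sqrt (by norm_num)]; norm_num
    have e2' : ⟪wcross (v - b) n₀, y - b⟫_ℝ ^ 2 ≤ 1 / 12 := by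
      rw [← h36, ← sq_abs]; exact pow_le_pow_left₀ (abs_nonneg _) e2 2
    have e3' : ⟪n₀, y - b⟫_ℝ ^ 2 ≤ 2 / 3 := by
      rw [← hB_sq, ← sq_abs]; exact pow_le_pow_left₀ (abs_nonneg _) e3 2
    nlinarith [norm_nonneg (y - b)]

/-- **Every entry collects at most `(2/3)√2` of contact area (one orientation).** -/
theorem charge_sum_le (I : TexInput rc μ) (β : Fin rc.nr × E3 × E3) :
    ∑ j, ∑ j', charge I β j j' ≤ 2 * (Real.sqrt 3 / 6) * (2 * hB) := by
  classical
  by_cases hG : ‖β.2.2 - β.2.1‖ = 1 ∧ ⟪β.2.2 - β.2.1, rc.rn β.1⟫_ℝ = 0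
  · obtain ⟨hRc, hRb, hRpl⟩ := wallRect_props hG.1 (rc.hrn β.1) hG.2
    have hq1 : ‖(bdat β).1‖ = 1 := hG.1
    have hle := I.wall_sum_le hq1 (R := wallRect β.2.1 β.2.2 (rc.rn β.1)) hRpl hRc hRb
    have hcollapse : ∑ j, ∑ j', charge I β j j' =
        ∑ j ∈ Finset.univ.filter (fun j => bdat β ∈ I.cells.Hp j ∧
            closure (polytope (I.cells.Hp j)) ∩ {y : E3 | ⟪(bdat β).1, y⟫_ℝ = (bdat β).2} ⊆ wallRect β.2.1 β.2.2 (rc.rn β.1)),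
          ∑ j' ∈ Finset.univ.filter (fun j' => antip (bdat β) ∈ I.cells.Hp j'), facetArea (I.contact j j' (bdat β)) (bdat β).1 := by
      rw [Finset.sum_filter]
      refine Finset.sum_congr rfl fun j _ => ?_
      rw [Finset.sum_filter]
      split_ifs with hj
      · refine Finset.sum_congr rfl fun j' _ => ?_
        unfold charge
        by_cases h2 : antip (bdat β) ∈ I.cells.Hp j'
        · rw [if_pos ⟨hG, hj.1, hj.2, h2⟩, if_pos h2]
        · rw [if_neg (fun h => h2 h.2.2.2), if_neg h2]
      · refine Finset.sum_eq_zero fun j' _ => ?_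
        unfold charge
        rw [if_neg]
        exact fun h => hj ⟨h.2.1, h.2.2.1⟩
    rw [hcollapse]
    exact hle.trans (facetArea_wallRect_le hG.1 (rc.hrn β.1) hG.2 subset_rfl)
  · have h0 : ∑ j, ∑ j', charge I β j j' = 0 := by
      refine Finset.sum_eq_zero fun j _ => Finset.sum_eq_zero fun j' _ => ?_
      unfold charge; rw [if_neg]; exact fun h => hG h.1
    rw [h0]; positivity

end Budget

/-! ### One curtain term against its charges -/

namespace Mesh₇

variable {C R₀ : ℝ} {N : ℕ} {x : Fin N → E3} {rc : RiseredCover C R₀ N x} {δ : ℝ} (μ : Mesh₇ rc δ)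
  (ct : (f : Fin rc.ng) → TentCert (rc.tent f)) (τ : Fin rc.nk → ℝ)

/-- Facts about the entry `(r', c, c + rL d_t)` produced by `owner_of_key`: membership in `bud`, its datum is the wall datum, and it is good. -/
theorem bud_entry {r r' : Fin rc.nr} {c : E3} {t : Fin 6} (hown : c ∈ rc.rown r') (hV : c + μ.toMesh₅.rL r (sixDir t) ∈ rc.rV r' c)
    (hvac : c + μ.toMesh₅.rL r (sixDir t) ∉ rc.X') (hrn : rc.rn r' = rc.rn r ∨ rc.rn r' = -rc.rn r) :
    (r', c, c + μ.toMesh₅.rL r (sixDir t)) ∈ bud rc ∧ bdat (r', c, c + μ.toMesh₅.rL r (sixDir t)) = μ.toMesh₅.hexWall r c t ∧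
      (‖c + μ.toMesh₅.rL r (sixDir t) - c‖ = 1 ∧ ⟪c + μ.toMesh₅.rL r (sixDir t) - c, rc.rn r'⟫_ℝ = 0) := by
  classical
  refine ⟨?_, ?_, ?_⟩
  · simp only [bud, Finset.mem_biUnion, Finset.mem_univ, true_and, Finset.mem_image, Finset.mem_sdiff]
    exact ⟨r', c, hown, _, ⟨hV, hvac⟩, rfl⟩
  · simp only [bdat, Mesh₅.hexWall, add_sub_cancel_left]
  · refine ⟨?_, ?_⟩
    · rw [add_sub_cancel_left, LinearIsometryEquiv.norm_map, norm_sixDir]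
    · rw [add_sub_cancel_left]
      have h0 := μ.toMesh₅.inner_hexWall_rn r c t
      simp only [Mesh₅.hexWall] at h0
      rcases hrn with h | h
      · rw [h]; exact h0
      · rw [h, inner_neg_right, h0, neg_zero]

/-- The facet of a cell inside `G_c` along the wall datum lies in the wall rectangle (any `n₀ = ± rn r`). -/
theorem facet_subset_wallRect {j : Fin (μ.toMesh₅.riserInput ct τ).cells.M} {r r' : Fin rc.nr} {c : E3} {t : Fin 6} (hc : c ∈ μ.toMesh₅.occF r)
    (hjc : polytope ((μ.toMesh₅.riserInput ct τ).cells.Hp j) ⊆ polytope (μ.toMesh₅.hexPrism r c (μ.toMesh₅.rlayer r c)))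
    (hrn : rc.rn r' = rc.rn r ∨ rc.rn r' = -rc.rn r) :
    closure (polytope ((μ.toMesh₅.riserInput ct τ).cells.Hp j)) ∩ {y : E3 | ⟪(μ.toMesh₅.hexWall r c t).1, y⟫_ℝ = (μ.toMesh₅.hexWall r c t).2} ⊆
      wallRect c (c + μ.toMesh₅.rL r (sixDir t)) (rc.rn r') := by
  obtain ⟨-, hcS, -⟩ := μ.toMesh₅.mem_occF.1 hc
  obtain ⟨m, a, b, hce⟩ := μ.toMesh₅.exists_eq_site hcS
  have hch : μ.toMesh₅.rheight r c = (m : ℝ) * hB := by rw [hce, μ.toMesh₅.rheight_site]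
  have hl : μ.toMesh₅.rlayer r c = m := by rw [hce, μ.toMesh₅.rlayer_site]
  rw [hl] at hjc
  exact fun y hy => μ.toMesh₅.closure_hexPrism_inter_plane_subset_wallRect hch t hrn ⟨closure_mono hjc hy.1, hy.2⟩

open scoped Classical in
/-- **ONE CURTAIN TERM ≤ (13/50)·(its charges, both orientations).** -/
theorem curtain_term_le {i i' : Fin (μ.toMesh₅.riserInput ct τ).cells.M}
    (hcls : (μ.toMesh₅.riserInput ct τ).cells.cls i' ≠ (μ.toMesh₅.riserInput ct τ).cells.cls i) {p : E3 × ℝ}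
    (hp : p ∈ (μ.toMesh₅.riserInput ct τ).cells.Hp i) (hcs : (μ.toMesh₅.riserInput ct τ).IsCurtainSpecial i i' p) :
    lawW (μ.toMesh₅.riserInput ct τ).frameOf ((μ.toMesh₅.riserInput ct τ).cells.cls i) ((μ.toMesh₅.riserInput ct τ).cells.cls i') p.1 *
        facetArea ((μ.toMesh₅.riserInput ct τ).contact i i' p) p.1 ≤
      13 / 50 * ((∑ β ∈ bud rc, if p = bdat β then charge (μ.toMesh₅.riserInput ct τ) β i i' else 0) +
        ∑ β ∈ bud rc, if antip p = bdat β then charge (μ.toMesh₅.riserInput ct τ) β i' i else 0) := by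
  have hne : i ≠ i' := (μ.toMesh₅.riserInput ct τ).ne_of_cls_ne hcls
  have hS1 : 0 ≤ ∑ β ∈ bud rc, (if p = bdat β then charge (μ.toMesh₅.riserInput ct τ) β i i' else 0) :=
    Finset.sum_nonneg fun β _ => by split_ifs; exacts [charge_nonneg _ _ _ _, le_rfl]
  have hS2 : 0 ≤ ∑ β ∈ bud rc, (if antip p = bdat β then charge (μ.toMesh₅.riserInput ct τ) β i' i else 0) :=
    Finset.sum_nonneg fun β _ => by split_ifs; exacts [charge_nonneg _ _ _ _, le_rfl]
  have hp1 : ‖p.1‖ = 1 := (μ.toMesh₅.riserInput ct τ).cells.hunit_Hp i p hp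
  have hlaw := lawW_le (μ.toMesh₅.riserInput ct τ).frameOf ((μ.toMesh₅.riserInput ct τ).cells.cls i) ((μ.toMesh₅.riserInput ct τ).cells.cls i') hp1
  have hA0 := facetArea_nonneg ((μ.toMesh₅.riserInput ct τ).contact i i' p) p.1
  rcases μ.toMesh₅.curtain_term_zero_or_key ct τ hcls hp hcs with h0 | ⟨r, c, t, hc, hi, hi', hg, hic, hpw⟩ | ⟨r, c, t, hc, hi', hi, hg, hi'c, hpw⟩
  · rw [h0]; positivity
  · -- KEY⁺
    by_cases hA : facetArea ((μ.toMesh₅.riserInput ct τ).contact i i' p) p.1 = 0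
    · rw [hA, mul_zero]; positivity
    obtain ⟨r', hown, hV, hvac, hrn⟩ := μ.owner_of_key ct τ hp hc hi hi' hg hic hpw hA
    obtain ⟨hβ, hdat, hgood⟩ := μ.bud_entry hown hV hvac hrn
    rw [← hpw] at hdat
    have hap : antip p ∈ (μ.toMesh₅.riserInput ct τ).cells.Hp i' := by
      have hp𝓗 : p ∈ (μ.toMesh₅.riserInput ct τ).𝓗 :=
        μ.toMesh₅.hexPrism_subset_𝓗 ct τ hc (by rw [hpw]; exact μ.toMesh₅.mem_hexPrism_iff.2 (Or.inl ⟨t, rfl⟩))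
      rcases (μ.toMesh₅.riserInput ct τ).mem_Hp_or_antip_mem i' hp𝓗 with h | h
      · exact absurd ((μ.toMesh₅.riserInput ct τ).facetArea_contact_eq_zero_of_mem_both hne hp h) hA
      · exact h
    have hch : charge (μ.toMesh₅.riserInput ct τ) (r', c, c + μ.toMesh₅.rL r (sixDir t)) i i' =
        facetArea ((μ.toMesh₅.riserInput ct τ).contact i i' p) p.1 := by
      unfold charge
      rw [if_pos ⟨hgood, by rw [hdat]; exact hp, by rw [hdat, hpw]; exact μ.facet_subset_wallRect ct τ hc hic hrn, by rw [hdat]; exact hap⟩, hdat]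
    have hsingle : facetArea ((μ.toMesh₅.riserInput ct τ).contact i i' p) p.1 ≤
        ∑ β ∈ bud rc, (if p = bdat β then charge (μ.toMesh₅.riserInput ct τ) β i i' else 0) := by
      have := Finset.single_le_sum (f := fun β => if p = bdat β then charge (μ.toMesh₅.riserInput ct τ) β i i' else 0)
        (fun β _ => ite_nonneg (charge_nonneg _ _ _ _) le_rfl) hβ
      simp only [hdat, if_true] at this
      rw [hch] at this
      exact this
    have hl0 := lawW_nonneg (μ.toMesh₅.riserInput ct τ).frameOf ((μ.toMesh₅.riserInput ct τ).cells.cls i) ((μ.toMesh₅.riserInput ct τ).cells.cls i') p.1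
    have hlaw' : lawW (μ.toMesh₅.riserInput ct τ).frameOf ((μ.toMesh₅.riserInput ct τ).cells.cls i) ((μ.toMesh₅.riserInput ct τ).cells.cls i') p.1
        ≤ 13 / 25 / 2 := hlaw
    nlinarith
  · -- KEY⁻: read the term from the other side
    have hq : antip p ∈ (μ.toMesh₅.riserInput ct τ).cells.Hp i' :=
      (μ.toMesh₅.riserInput ct τ).mem_Hp_of_subset (μ.toMesh₅.hexPrism_subset_𝓗 ct τ hc) hi'c
        (by rw [hpw]; exact μ.toMesh₅.mem_hexPrism_iff.2 (Or.inl ⟨t, rfl⟩))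
    have hflip : facetArea ((μ.toMesh₅.riserInput ct τ).contact i i' p) p.1 =
        facetArea ((μ.toMesh₅.riserInput ct τ).contact i' i (antip p)) (antip p).1 := by
      conv_lhs => rw [← antip_antip p]
      exact (μ.toMesh₅.riserInput ct τ).facetArea_contact_antip i i' (antip p)
    by_cases hA : facetArea ((μ.toMesh₅.riserInput ct τ).contact i' i (antip p)) (antip p).1 = 0
    · rw [hflip, hA, mul_zero]; positivity
    obtain ⟨r', hown, hV, hvac, hrn⟩ := μ.owner_of_key ct τ hq hc hi' hi hg hi'c hpw hA
    obtain ⟨hβ, hdat, hgood⟩ := μ.bud_entry hown hV hvac hrn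
    rw [← hpw] at hdat
    have hch : charge (μ.toMesh₅.riserInput ct τ) (r', c, c + μ.toMesh₅.rL r (sixDir t)) i' i =
        facetArea ((μ.toMesh₅.riserInput ct τ).contact i' i (antip p)) (antip p).1 := by
      unfold charge
      rw [if_pos ⟨hgood, by rw [hdat]; exact hq, by rw [hdat, hpw]; exact μ.facet_subset_wallRect ct τ hc hi'c hrn,
        by rw [hdat, antip_antip]; exact hp⟩, hdat]
    have hsingle : facetArea ((μ.toMesh₅.riserInput ct τ).contact i' i (antip p)) (antip p).1 ≤
        ∑ β ∈ bud rc, (if antip p = bdat β then charge (μ.toMesh₅.riserInput ct τ) β i' i else 0) := by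
      have := Finset.single_le_sum (f := fun β => if antip p = bdat β then charge (μ.toMesh₅.riserInput ct τ) β i' i else 0)
        (fun β _ => ite_nonneg (charge_nonneg _ _ _ _) le_rfl) hβ
      simp only [hdat, if_true] at this
      rw [hch] at this
      exact this
    rw [hflip]
    have hlaw' : lawW (μ.toMesh₅.riserInput ct τ).frameOf ((μ.toMesh₅.riserInput ct τ).cells.cls i) ((μ.toMesh₅.riserInput ct τ).cells.cls i') p.1
        ≤ 13 / 25 / 2 := hlaw
    have hA0' := facetArea_nonneg ((μ.toMesh₅.riserInput ct τ).contact i' i (antip p)) (antip p).1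
    have hl0 := lawW_nonneg (μ.toMesh₅.riserInput ct τ).frameOf ((μ.toMesh₅.riserInput ct τ).cells.cls i) ((μ.toMesh₅.riserInput ct τ).cells.cls i') p.1
    nlinarith

/-! ### The count -/

/-- Collapsing the datum sum: `Σ_{p ∈ Hp i} [p = bdat β]·charge ≤ charge`. -/
theorem sum_ite_bdat_le (I : TexInput rc μ.toMesh₅) (i i' : Fin I.cells.M) (β : Fin rc.nr × E3 × E3) :
    (∑ p ∈ I.cells.Hp i, if p = bdat β then charge I β i i' else 0) ≤ charge I β i i' := by
  classical
  rw [Finset.sum_ite_eq']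
  split_ifs; exacts [le_rfl, charge_nonneg _ _ _ _]

/-- The same for the reversed orientation: `Σ_{p ∈ Hp i} [antip p = bdat β]·charge' ≤ charge'`. -/
theorem sum_ite_antip_bdat_le (I : TexInput rc μ.toMesh₅) (i i' : Fin I.cells.M) (β : Fin rc.nr × E3 × E3) :
    (∑ p ∈ I.cells.Hp i, if antip p = bdat β then charge I β i' i else 0) ≤ charge I β i' i := by
  classical
  have h : ∀ p : E3 × ℝ, (antip p = bdat β) = (p = antip (bdat β)) := fun p =>
    propext ⟨fun e => by rw [← e, antip_antip], fun e => by rw [e, antip_antip]⟩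
  simp only [h]
  rw [Finset.sum_ite_eq']
  split_ifs; exacts [le_rfl, charge_nonneg _ _ _ _]

open scoped Classical in
/-- **THE CURTAIN COUNT**: `curtainSpecialSum ≤ riserSum` for the riser input — the SECOND conjunct of `RiserPackage₇`. -/
theorem riserInput_curtain : (μ.toMesh₅.riserInput ct τ).curtainSpecialSum ≤ rc.riserSum := by
  set I := μ.toMesh₅.riserInput ct τ with hI
  set w₀ : ℝ := 2 * (Real.sqrt 3 / 6) * (2 * hB) with hw₀
  have hw₀0 : 0 ≤ w₀ := by rw [hw₀]; positivity
  set g₁ : Fin I.cells.M → Fin I.cells.M → (E3 × ℝ) → (Fin rc.nr × E3 × E3) → ℝ :=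
    fun i i' p β => if p = bdat β then charge I β i i' else 0 with hg₁
  set g₂ : Fin I.cells.M → Fin I.cells.M → (E3 × ℝ) → (Fin rc.nr × E3 × E3) → ℝ :=
    fun i i' p β => if antip p = bdat β then charge I β i' i else 0 with hg₂
  -- Step 1: termwise bound and enlarging the index sets
  have hstep1 : I.curtainSpecialSum ≤ 13 / 50 * ∑ i, ∑ i', ∑ p ∈ I.cells.Hp i, (∑ β ∈ bud rc, g₁ i i' p β + ∑ β ∈ bud rc, g₂ i i' p β) := by
    unfold TexInput.curtainSpecialSum
    rw [Finset.mul_sum]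
    refine Finset.sum_le_sum fun i _ => ?_
    rw [Finset.mul_sum]
    have hnn : ∀ i' : Fin I.cells.M, 0 ≤ 13 / 50 * ∑ p ∈ I.cells.Hp i, (∑ β ∈ bud rc, g₁ i i' p β + ∑ β ∈ bud rc, g₂ i i' p β) := by
      intro i'
      refine mul_nonneg (by norm_num) (Finset.sum_nonneg fun p _ => add_nonneg ?_ ?_) <;>
        refine Finset.sum_nonneg fun β _ => ?_ <;> simp only [hg₁, hg₂] <;> split_ifs <;> first | exact charge_nonneg _ _ _ _ | exact le_rfl
    refine (Finset.sum_le_sum fun i' hi' => ?_).trans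
      (Finset.sum_le_sum_of_subset_of_nonneg (Finset.filter_subset _ _) fun i' _ _ => hnn i')
    have hcls := (Finset.mem_filter.1 hi').2
    rw [Finset.mul_sum]
    have hnn' : ∀ p : E3 × ℝ, 0 ≤ 13 / 50 * (∑ β ∈ bud rc, g₁ i i' p β + ∑ β ∈ bud rc, g₂ i i' p β) := by
      intro p
      refine mul_nonneg (by norm_num) (add_nonneg ?_ ?_) <;>
        refine Finset.sum_nonneg fun β _ => ?_ <;> simp only [hg₁, hg₂] <;> split_ifs <;> first | exact charge_nonneg _ _ _ _ | exact le_rfl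
    refine (Finset.sum_le_sum fun p hp => ?_).trans
      (Finset.sum_le_sum_of_subset_of_nonneg (Finset.filter_subset _ _) fun p _ _ => hnn' p)
    obtain ⟨hpH, hcs⟩ := Finset.mem_filter.1 hp
    exact μ.curtain_term_le ct τ hcls hpH hcs
  -- Step 2: collapse the datum sums
  have hstep2 : ∀ i i', ∑ p ∈ I.cells.Hp i, (∑ β ∈ bud rc, g₁ i i' p β + ∑ β ∈ bud rc, g₂ i i' p β) ≤
      ∑ β ∈ bud rc, charge I β i i' + ∑ β ∈ bud rc, charge I β i' i := by
    intro i i'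
    rw [Finset.sum_add_distrib, Finset.sum_comm, Finset.sum_comm (s := I.cells.Hp i)]
    exact add_le_add (Finset.sum_le_sum fun β _ => μ.sum_ite_bdat_le I i i' β) (Finset.sum_le_sum fun β _ => μ.sum_ite_antip_bdat_le I i i' β)
  -- Step 3: reorder and bound each entry's charges
  have hstep3 : ∑ i, ∑ i', (∑ β ∈ bud rc, charge I β i i' + ∑ β ∈ bud rc, charge I β i' i) ≤ 2 * ((bud rc).card * w₀) := by
    have eA : ∑ i, ∑ i', ∑ β ∈ bud rc, charge I β i i' = ∑ β ∈ bud rc, ∑ i, ∑ i', charge I β i i' :=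
      calc ∑ i, ∑ i', ∑ β ∈ bud rc, charge I β i i' = ∑ i, ∑ β ∈ bud rc, ∑ i', charge I β i i' :=
            Finset.sum_congr rfl fun i _ => Finset.sum_comm
        _ = ∑ β ∈ bud rc, ∑ i, ∑ i', charge I β i i' := Finset.sum_comm
    have eB : ∑ i, ∑ i', ∑ β ∈ bud rc, charge I β i' i = ∑ β ∈ bud rc, ∑ i, ∑ i', charge I β i' i :=
      calc ∑ i, ∑ i', ∑ β ∈ bud rc, charge I β i' i = ∑ i, ∑ β ∈ bud rc, ∑ i', charge I β i' i :=
            Finset.sum_congr rfl fun i _ => Finset.sum_comm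
        _ = ∑ β ∈ bud rc, ∑ i, ∑ i', charge I β i' i := Finset.sum_comm
    have hsplit : ∑ i, ∑ i', (∑ β ∈ bud rc, charge I β i i' + ∑ β ∈ bud rc, charge I β i' i) =
        ∑ β ∈ bud rc, (∑ i, ∑ i', charge I β i i') + ∑ β ∈ bud rc, (∑ i, ∑ i', charge I β i' i) := by
      rw [← eA, ← eB, ← Finset.sum_add_distrib]
      refine Finset.sum_congr rfl fun i _ => ?_
      rw [Finset.sum_add_distrib]
    rw [hsplit]
    have hB1 : ∑ β ∈ bud rc, (∑ i, ∑ i', charge I β i i') ≤ (bud rc).card * w₀ := by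
      have := Finset.sum_le_sum fun β (_ : β ∈ bud rc) => charge_sum_le I β
      rw [Finset.sum_const, nsmul_eq_mul] at this
      exact this
    have hB2 : ∑ β ∈ bud rc, (∑ i, ∑ i', charge I β i' i) ≤ (bud rc).card * w₀ := by
      have := Finset.sum_le_sum fun β (_ : β ∈ bud rc) => (le_of_eq Finset.sum_comm).trans (charge_sum_le I β)
      rw [Finset.sum_const, nsmul_eq_mul] at this
      exact this
    linarith
  have hcard := card_bud_le rc
  have hconst := curtain_constant_le_one
  have hrs := rc.riserSum_nonneg
  calc I.curtainSpecialSum ≤ 13 / 50 * ∑ i, ∑ i', ∑ p ∈ I.cells.Hp i, (∑ β ∈ bud rc, g₁ i i' p β + ∑ β ∈ bud rc, g₂ i i' p β) := hstep1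
    _ ≤ 13 / 50 * ∑ i, ∑ i', (∑ β ∈ bud rc, charge I β i i' + ∑ β ∈ bud rc, charge I β i' i) := by
        refine mul_le_mul_of_nonneg_left (Finset.sum_le_sum fun i _ => Finset.sum_le_sum fun i' _ => hstep2 i i') (by norm_num)
    _ ≤ 13 / 50 * (2 * ((bud rc).card * w₀)) := mul_le_mul_of_nonneg_left hstep3 (by norm_num)
    _ ≤ 13 / 50 * (2 * (2 * rc.riserSum * w₀)) := by nlinarith
    _ = (26 / 25 * w₀) * rc.riserSum := by ring
    _ ≤ 1 * rc.riserSum := mul_le_mul_of_nonneg_right hconst hrs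
    _ = rc.riserSum := one_mul _

end Mesh₇

end Summit.Ventures.Crystal3D.Cruxes.TextureLiminf.TexShadow

end
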